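import Literature.AlgebraicGeometry.Resolution.ResolutionLU
import Mathlib.AlgebraicGeometry.Morphisms.UniversallyInjective
import Mathlib.AlgebraicGeometry.Morphisms.Finite

/-!
# `Picover` — negative-lane helpers: the radicial cover `Spec S[y] → Spec S` (`y^p ∈ S`) and
# "resolution of `Spec S[t]` ⇒ local uniformization of `Frac S[t]`"

Support lemmas for crux `stmt-ResolutionOfSingularities-0554`
(`Summit.ResolutionOfSingularities.ResolutionOfSingularities.Theses.PAlteration.Picover`), filed by
the standing disprover (cdisprove gen 1; work file `Cruxes/Picover/Disproof.lean`, §2g) and used by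
the negative lemma `ExcellenceLoadBearing.lean` (same directory): the crux is FALSE over a regular
NON-excellent base. This file declares NO definition.

* `isFinite_Spec_adjoin`, `surjective_Spec_adjoin`, `ringHom_adjoin_ext_of_pow_mem`,
  `universallyInjective_Spec_adjoin_of_pow_eq` — for `S → F` (a field of characteristic `p`) and
  `y ∈ F` with `y ^ p ∈ S`, the cover `Spec S[y] → Spec S` is finite, surjective (lying over) and
  UNIVERSALLY INJECTIVE (Stacks 01S4, Mathlib `tfae_universallyInjective` (1) ⇔ (2): a `K'`-point
  of `Spec S[y]` is determined by its restriction to `S`, since Frobenius is injective on `K'`).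
  This is the shape of the hypotheses of the crux (and of the local model, crux stmt-0557).
* `exists_model_of_hasResolution_adjoin` — if `Spec S[t]` (`Frac S[t] = F`) has a resolution of
  singularities then along every valuation ring `O ⊇ S[t]` of `F` there is a finitely generated
  `S`-subalgebra `A ∋ t` of `F` inside `O`, `Frac A = F`, regular at the centre of `O` (the tree's
  `exists_fg_regular_of_hasResolution` — valuative criterion of properness — repackaged over `S`).
* `inv_mem_of_isIntegral_inv` — `s ∈ A`, `s⁻¹` integral over `A` ⇒ `s⁻¹ ∈ A`.

## Sources
* The Stacks Project, Tag 01S4 (universally injective = radicial). [StacksProject]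
* O. Zariski, *Local uniformization on algebraic varieties*, Ann. of Math. 41 (1940) (resolution
  ⇒ local uniformization; tree `ResolutionLU.lean`).
-/

noncomputable section

open CategoryTheory AlgebraicGeometry TopologicalSpace IsLocalRing
open Literature.AlgebraicGeometry.Resolution

set_option linter.dupNamespace false

namespace Summit.ResolutionOfSingularities.ResolutionOfSingularities.Theorems.Picover.Negative

/-! ### The purely inseparable cover `Spec S[y] → Spec S`, `y ^ p ∈ S` -/

section RadicialCover

variable {S F : Type} [CommRing S] [Field F] [Algebra S F]

/-- `Spec S[y] → Spec S` is finite when `y` is integral. [folklore] -/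
theorem isFinite_Spec_adjoin {y : F} (hy : IsIntegral S y) :
    IsFinite (Spec.map (CommRingCat.ofHom (algebraMap S (Algebra.adjoin S ({y} : Set F))))) := by
  haveI : Module.Finite S (Algebra.adjoin S ({y} : Set F)) :=
    ⟨(Submodule.fg_top _).mpr hy.fg_adjoin_singleton⟩
  rw [IsFinite.SpecMap_iff, CommRingCat.hom_ofHom]
  exact RingHom.finite_algebraMap.mpr inferInstance

/-- `Spec S[y] → Spec S` is surjective when `y` is integral and `S → F` is injective (lying
over). [folklore] -/
theorem surjective_Spec_adjoin {y : F} (hy : IsIntegral S y)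
    (hinj : Function.Injective (algebraMap S F)) :
    Function.Surjective (Spec.map (CommRingCat.ofHom
      (algebraMap S (Algebra.adjoin S ({y} : Set F))))).base := by
  haveI : Module.Finite S (Algebra.adjoin S ({y} : Set F)) :=
    ⟨(Submodule.fg_top _).mpr hy.fg_adjoin_singleton⟩
  have hint : (algebraMap S (Algebra.adjoin S ({y} : Set F))).IsIntegral :=
    RingHom.Finite.to_isIntegral (RingHom.finite_algebraMap.mpr inferInstance)
  have hinj' : Function.Injective (algebraMap S (Algebra.adjoin S ({y} : Set F))) := by
    intro a b hab
    apply hinj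
    have := congrArg (fun r : Algebra.adjoin S ({y} : Set F) => (r : F)) hab
    simpa using this
  intro q
  obtain ⟨x, hx⟩ := RingHom.IsIntegral.comap_surjective hint hinj' q
  exact ⟨x, by rw [← hx]; rfl⟩

/-- Two ring homomorphisms `S[y] → K'` into a field of characteristic `p` which agree on `S`
agree, provided `y ^ p ∈ S` (Frobenius is injective on `K'`). [folklore] -/
theorem ringHom_adjoin_ext_of_pow_mem (p : ℕ) [Fact p.Prime] {y : F} {a : S}
    (hy : y ^ p = algebraMap S F a) {K' : Type*} [Field K'] [CharP K' p]
    (φ₁ φ₂ : Algebra.adjoin S ({y} : Set F) →+* K')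
    (h : φ₁.comp (algebraMap S _) = φ₂.comp (algebraMap S _)) : φ₁ = φ₂ := by
  have hyR : (⟨y, Algebra.self_mem_adjoin_singleton S y⟩ : Algebra.adjoin S ({y} : Set F)) ^ p =
      algebraMap S _ a :=
    Subtype.ext (by rw [SubmonoidClass.coe_pow]; exact hy)
  have hyK : φ₁ ⟨y, Algebra.self_mem_adjoin_singleton S y⟩ =
      φ₂ ⟨y, Algebra.self_mem_adjoin_singleton S y⟩ := by
    apply frobenius_inj K' p
    rw [frobenius_def, frobenius_def, ← map_pow, ← map_pow, hyR]
    exact RingHom.congr_fun h a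
  refine RingHom.ext fun r => ?_
  obtain ⟨r, hr⟩ := r
  have hr' := hr
  rw [Algebra.adjoin_singleton_eq_range_aeval, AlgHom.mem_range] at hr'
  obtain ⟨q, rfl⟩ := hr'
  have hq : (⟨Polynomial.aeval y q, hr⟩ : Algebra.adjoin S ({y} : Set F)) =
      Polynomial.aeval (⟨y, Algebra.self_mem_adjoin_singleton S y⟩ : Algebra.adjoin S ({y} : Set F))
        q := by
    apply Subtype.ext
    rw [Polynomial.aeval_subalgebra_coe]
  rw [hq]
  simp only [Polynomial.aeval_def, Polynomial.hom_eval₂, h, hyK]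

/-- **`Spec S[y] → Spec S` is universally injective when `y ^ p ∈ S`** (`char = p`): by Stacks
01S4 (Mathlib `tfae_universallyInjective`, (1) ⇔ (2)) it suffices that `K'`-points are injective
over `Spec S`, which is `ringHom_adjoin_ext_of_pow_mem`. [cite: StacksProject, Tag 01S4] -/
theorem universallyInjective_Spec_adjoin_of_pow_eq (p : ℕ) [Fact p.Prime] [CharP F p] {y : F}
    {a : S} (hy : y ^ p = algebraMap S F a) :
    UniversallyInjective (Spec.map (CommRingCat.ofHom
      (algebraMap S (Algebra.adjoin S ({y} : Set F))))) := by
  set R := Algebra.adjoin S ({y} : Set F)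
  haveI : CharP R p := (algebraMap R F).charP Subtype.val_injective p
  refine ((tfae_universallyInjective
    (Spec.map (CommRingCat.ofHom (algebraMap S R)))).out 0 1).mpr ?_
  intro K' _ a₁ a₂ ha
  obtain ⟨φ₁, rfl⟩ := Spec.map_surjective a₁
  obtain ⟨φ₂, rfl⟩ := Spec.map_surjective a₂
  have ha' : CommRingCat.ofHom (algebraMap S R) ≫ φ₁ = CommRingCat.ofHom (algebraMap S R) ≫ φ₂ := by
    apply Spec.map_injective
    simpa only [Spec.map_comp] using ha
  -- `K'` has characteristic `p`
  have hp0 : (p : K') = 0 := by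
    have := congrArg φ₁.hom (CharP.cast_eq_zero R p)
    rwa [map_natCast, map_zero] at this
  haveI : CharP K' p := (CharP.charP_iff_prime_eq_zero (Fact.out : p.Prime)).mpr hp0
  have : φ₁.hom = φ₂.hom := ringHom_adjoin_ext_of_pow_mem p hy φ₁.hom φ₂.hom (by
    have := congrArg CommRingCat.Hom.hom ha'
    simpa using this)
  rw [show φ₁ = φ₂ from CommRingCat.hom_ext this]

end RadicialCover

/-! ### Resolution of `Spec S[t]` gives a regular finitely generated model along every
valuation ring (Zariski 1940 read backwards, via the tree's `exists_fg_regular_of_hasResolution`) -/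

/-- If `Spec S[t]` (`S[t] ⊆ F = Frac S[t]`) has a resolution of singularities then along every
valuation ring `O ⊇ S[t]` of `F` there is a finitely generated `S`-subalgebra `A ∋ t` of `F`
inside `O` with `Frac A = F` whose local ring at the centre of `O` is regular (valuative criterion
of properness; tree `exists_fg_regular_of_hasResolution`). [folklore] -/
theorem exists_model_of_hasResolution_adjoin {S F : Type} [CommRing S] [Field F] [Algebra S F]
    (O : ValuationSubring F) (t : F) (hSO : ∀ s : S, algebraMap S F s ∈ O) (htO : t ∈ O)
    (hfr : IsFractionRing (Algebra.adjoin S ({t} : Set F)) F)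
    (hres : Scheme.HasResolution (Spec (.of (Algebra.adjoin S ({t} : Set F))))) :
    ∃ (A : Subalgebra S F) (h : A.toSubring ≤ O.toSubring), t ∈ A ∧ A.FG ∧ IsFractionRing A F ∧
      IsRegularLocalRing (Localization.AtPrime (Ideal.comap (Subring.inclusion h)
        (IsLocalRing.maximalIdeal O))) := by
  set R := Algebra.adjoin S ({t} : Set F) with hRdef
  haveI : IsFractionRing R F := hfr
  have hRO : ∀ r : R, algebraMap R F r ∈ O := by
    rintro ⟨r, hr⟩
    change r ∈ O
    induction hr using Algebra.adjoin_induction with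
    | mem x hx =>
      rw [Set.mem_singleton_iff] at hx
      subst hx
      exact htO
    | algebraMap s => exact hSO s
    | add x y _ _ hx hy => exact add_mem hx hy
    | mul x y _ _ hx hy => exact mul_mem hx hy
  obtain ⟨T, hTO, hTfg, hreg⟩ := exists_fg_regular_of_hasResolution (A := R) (K := F) O hRO hres
  have hRT : ∀ r : R, (r : F) ∈ T := fun r => T.algebraMap_mem r
  refine ⟨T.restrictScalars S, hTO, hRT ⟨t, Algebra.self_mem_adjoin_singleton S t⟩, ?_, ?_, hreg⟩
  · haveI : Algebra.FiniteType R T := T.fg_iff_finiteType.mp hTfg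
    haveI : Algebra.FiniteType S R :=
      R.fg_iff_finiteType.mp ⟨{t}, by rw [Finset.coe_singleton]⟩
    have hST : Algebra.FiniteType S T := Algebra.FiniteType.trans (S := R) inferInstance inferInstance
    exact (T.restrictScalars S).fg_iff_finiteType.mpr hST
  · exact IsFractionRing.of_field (T.restrictScalars S) F fun x => by
      obtain ⟨a, b, _, rfl⟩ := IsFractionRing.div_surjective (A := R) x
      exact ⟨⟨a, hRT a⟩, ⟨b, hRT b⟩, rfl⟩

/-! ### An integrality lemma -/

/-- If `s ∈ A ⊆ F` and `s⁻¹` is integral over the subring `A`, then `s⁻¹ ∈ A`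
(`s⁻¹ = -(c_{n-1} + c_{n-2} s + ⋯ + c₀ s^{n-1})` from the monic equation of `s⁻¹`).
[folklore] -/
theorem inv_mem_of_isIntegral_inv {F : Type*} [Field F] {A : Subring F} {s : F} (hs : s ∈ A)
    (hint : IsIntegral A s⁻¹) : s⁻¹ ∈ A := by
  rcases eq_or_ne s 0 with rfl | hs0
  · rw [inv_zero]; exact A.zero_mem
  obtain ⟨q, hmon, hq⟩ := hint
  set n := q.natDegree with hn
  rw [Polynomial.eval₂_eq_sum_range, Finset.sum_range_succ, ← hn, hmon.coeff_natDegree, map_one,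
    one_mul] at hq
  set w : F := ∑ i ∈ Finset.range n, algebraMap A F (q.coeff i) * s ^ (n - 1 - i) with hw
  have hwA : w ∈ A := by
    refine Subring.sum_mem _ fun i _ => Subring.mul_mem _ (q.coeff i).2 (Subring.pow_mem _ hs _)
  have hkey : (∑ i ∈ Finset.range n, algebraMap A F (q.coeff i) * s⁻¹ ^ i) * s ^ n = s * w := by
    rw [hw, Finset.sum_mul, Finset.mul_sum]
    refine Finset.sum_congr rfl fun i hi => ?_
    rw [Finset.mem_range] at hi
    have hsplit : s ^ n = s ^ i * (s * s ^ (n - 1 - i)) := by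
      rw [← pow_succ', ← pow_add]; congr 1; omega
    rw [hsplit, inv_pow, mul_assoc, ← mul_assoc ((s ^ i)⁻¹), inv_mul_cancel₀ (pow_ne_zero _ hs0),
      one_mul, mul_left_comm]
  have h1 : s * w + 1 = 0 := by
    have := congrArg (· * s ^ n) hq
    simp only [add_mul, zero_mul, hkey] at this
    rwa [inv_pow, inv_mul_cancel₀ (pow_ne_zero _ hs0)] at this
  have hinv : s⁻¹ = -w := by
    rw [eq_neg_iff_add_eq_zero, ← mul_right_inj' hs0, mul_add, mul_inv_cancel₀ hs0, mul_zero,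
      add_comm]
    exact h1
  rw [hinv]
  exact A.neg_mem hwA

end Summit.ResolutionOfSingularities.ResolutionOfSingularities.Theorems.Picover.Negative

end
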